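import Mathlib
import HarnessLib
import HarnessLib.Audit
import Summits.QuantumFields.Statement

/-!
Route: ChiralSpinWaves

DORMANT since 2026-09-03T14:42:23Z (reconciler: no traction for 5 d (last activity statement-checked at 2026-08-29T13:53:54Z); parked, not closed — `ledger route dormant route-QuantumFields-ChiralSpinWaves --off` to reactivate) — unstaffed, not closed; items shared with open routes are served there. `ledger route dormant <id> --off` reactivates.

# Route ChiralSpinWaves — pions are spin waves — the chiral window of lattice QCD inherits the
two-sided √m law of a low-temperature principal chiral model

It suffices to show X = ChiralWindow ∧ MassiveBody, with ChiralWindow reached by the NEW lever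
SpinWaveLaws → ChiralWindow (ChiralTransfer).
ChiralWindow (target): for N_f = 2, 3 ONE mass-independent, asymptotically scaling regularisation
with leading-log Z_m whose light-quark
window (all m_f ≤ m₁) obeys the TWO-SIDED GOLDSTONE LAW on the lattice — a uniform lattice gap at
rate ≥ c·√(m₍₁₎+m₍₂₎) (the two lightest
flavours make the lightest meson; this is the ∀m-clause near zero) AND no uniform gap at any rate >
C·√m on the degenerate line (the
pseudo-Goldstone mode exists; this is `IsChiralAtZero` with the GMOR exponent, five lines of logic).
SpinWaveLaws (rank 2, the engine provers can attack now): the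
SU(2) and SU(3) principal chiral models on ℤ⁴ at low temperature β in a field h cluster
exponentially at rate ≍ √(h/β) two-sidedly (upper
for all cylinder observables, lower for the transverse two-point function) — Bałaban's
low-temperature expansion for a group-valued spin.
ChiralTransfer (rank 3, the open matching step): that law transfers to the chiral window of Wilson
lattice QCD (dictionary below). MassiveBody: a regularisation so
pinned (m_crit at the chiral point, Z_m calibrated by the law) realises the massive OS body at every
positive mass tuple. No card realised
(novel-route seat); nearest pool objects: AnomalyRigidity (other chiral mechanism),
DiagonalSpine.FullLatticeGap (pre-re-type lattice half).
Lean: `ChiralWindow ∧ MassiveBody`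

## Assembly
Pure logic, machine-checked sorry-free in the planner's Sketch.lean / glue.lean (`closes`, axioms
propext / Classical.choice / Quot.sound):
ChiralTransfer applied to SpinWaveLaws gives ChiralWindow; fix N_f ∈ {2,3} and take its reg
(HasMassScaling ✓); the upper law gives
`IsChiralAtZero` directly (given ε pick t = min(m₁, (ε/2C)²), then C√t < ε and the degenerate tuple
t·1 has no uniform gap ε); MassiveBody
gives the body at every positive tuple; hence QCDOf 2 ∧ QCDOf 3 = QCD.

Rationale: WHY THIS LINE. The re-typed conjunct (2026-08-16) pins the chiral point (`IsChiralAtZero`) and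
thereby drags every route into the light-quark regime, where
the infrared of QCD is not glue but PIONS: pseudo-Goldstone bosons with m_π² = 2Bm
(GellmannOakesRenner1968, GasserLeutwyler1984) — in the
language of statistical mechanics, SPIN WAVES of a low-temperature SU(N_f)-valued ferromagnet in a
magnetic field h ∝ m (dictionary: chiral
field U(x) ∈ SU(N_f) ↦ spin g_x; f_π² ↦ stiffness β; quark mass × condensate ↦ field h; pion ↦
transverse spin wave of mass² = h/β; σ/glue ↦
longitudinal two-magnon channel; `IsChiralAtZero` ↦ Goldstone theorem; the ∀m>0 gap near zero ↦ "a
field gaps the Goldstone mode").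
The one place in constructive physics where exactly this infrared is under rigorous multiscale
control is Bałaban's low-temperature
expansion for N-vector models (Balaban1995, Balaban1996, Balaban1998) with its correlation-function
analysis (BalabanOcarroll1999; elementary
RP/infrared-bound version without asymptotics: GiulianiOtt2023, FrohlichSimonSpencer1976). We import
that technology for the target
manifold SU(N_f) (S³ for N_f = 2, a genuinely group-valued field for N_f = 3) and state the transfer
to lattice QCD as the rank-3 crux (the engine SpinWaveLaws is rank 2: it decides whether the lever
exists and is attackable now) — the
typed form of "chiral perturbation theory is the infrared of QCD" (KawamotoSmit1981 is its
strong-coupling shadow). What no prior route does: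
all 27 other QCD theses prove only UPPER bounds on correlators and (except AnomalyRigidity, which
uses the 't Hooft anomaly and gets no rate)
have no mechanism for the chiral clause; this line makes the chiral clause a LOWER bound on a
correlator — the pion must propagate — with the
GMOR exponent on both sides, and hands the pool a typed two-sided window package (ChiralWindow) that
any route may want.

RANKED CRUXES. #0 ChiralWindow (target) — for N_f ∈ {2,3} there is a mass-independent regularisation
reg with HasMassScaling and two-loop asymptotic scaling and constants m₁, c, C > 0 such that (lower
law) for every positive mass tuple with all m_f ≤ m₁ the bare masses stay on the physical branch and
lattice QCD has the uniform lattice gap c·√(inf over f≠g of (m_f+m_g)), and (upper law) for every t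
∈ (0, m₁] and every E > C√t the degenerate-mass theory reg.scheme (t·1) has NO uniform lattice gap
E. (why it might fail: encodes Goldstone scaling: false if massless N_f = 2 QCD sat in an exotic
anomaly-matching phase (massless baryons, no condensate) where the gap is ∝ m ≪ √m — the lower law
dies; or if some flavour-singlet state dipped below c√(m₍₁₎+m₍₂₎) at small m.)
[GellmannOakesRenner1968, GasserLeutwyler1984, SharpeSingleton1998, MontvayMunster1994,
JaffeWitten2000]
#2 SpinWaveLaws (crux) — for N ∈ {2,3} there are β₀, h₀, c, C, c' > 0, K(·,·), L₀ such that for all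
β ≥ β₀, 0 < h ≤ h₀ and all tori (ℤ/L)⁴ with L ≥ L₀, the SU(N) principal chiral model with weight
exp(β Σ_x Σ_μ Re tr(g_x g_(x+μ)†) + h Σ_x Re tr g_x) ∏ dg_x (Haar) satisfies: (upper) |Cov(F,F')| ≤
K(|A|,|B|)·e^(−c√(h/β)·R) for cylinder observables F, F' bounded by 1, supported on A, B at torus
sup-distance ≥ R; (lower) Cov(u(g_0), u(g_y)) ≥ (c'/β)(1+|y|)⁻²·e^(−C√(h/β)|y|) for the transverse
coordinate u(g) = Im g₀₁ and 4|y| ≤ L — exponential clustering at the spin-wave mass √(h/β),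
two-sidedly, uniformly in the volume. [difficulty: XL] (why it might fail: N=2 (S³ = O(4) N-vector)
is Bałaban–O'Carroll territory but two-sidedness, tori and uniformity down to h→0⁺ are unverified
(paper paywalled); N=3 needs the low-T expansion rebuilt for a group-valued field (π₃(SU(3)) = ℤ
textures); the lower law needs transverse positivity at all distances.) [Balaban1995, Balaban1996,
Balaban1998, BalabanOcarroll1999, GiulianiOtt2023, FrohlichSimonSpencer1976]
#3 ChiralTransfer (crux) — the spin-wave laws of the SU(2)/SU(3) principal chiral models
(SpinWaveLaws) imply ChiralWindow: blocked to the chiral scale ℓ_χ, light-quark Wilson lattice QCD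
along a suitably tuned AF regularisation is a low-temperature SU(N_f) principal chiral model in a
field h ≍ B·m·ℓ_χ⁴-units (plus a massive remainder), so the PCM's two-sided √(h/β) law becomes the
two-sided √m law of the window, with m_crit(k) := the bare mass of vanishing effective field and
Z_m(k) read off the law. [deps: SpinWaveLaws] [difficulty: open-problem] (why it might fail: needs
SχSB and a derivation of the chiral Lagrangian from blocked lattice QCD in Bałaban's format — no
rigorous handle at N_c = 3; the blocked measure may be no small perturbation of any PCM (σ/ρ at the
matching scale, Wilson O(a) chirality breaking, signed determinant).) [KawamotoSmit1981,
GasserLeutwyler1984, SharpeSingleton1998, BalabanOcarroll1999, MontvayMunster1994]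
#4 MassiveBody (crux) — for N_f ∈ {2,3}, every regularisation with HasMassScaling, asymptotic
scaling and the two window laws of ChiralWindow realises the OS body of QCDOf at EVERY positive mass
tuple: species renormalisations and OS data with IsQCDAlong, non-trivial non-Gaussian glue,
non-decoupled flavour-changing pseudoscalars, and one Δ(m) > 0 for T.HasMassGap and
HasLatticeMassGap — the pre-re-type programme, for a reg whose m_crit and Z_m are pinned by the
window (no threshold freedom). [deps: ChiralTransfer] [difficulty: open-problem] (why it might fail:
this is the old pool target in full (UV with light dynamical Wilson quarks, E0–E4 incl. rotations,
gluonic gap at every mass incl. the intermediate strange-like regime m₁ < m ≲ Λ), now without the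
m_crit-shift escape; any of those can fail or stay out of reach.) [JaffeWitten2000,
OsterwalderSeiler1978, MontvayMunster1994, Luscher1977, Balaban1995]

TWO-LAYER PLAN. ChiralTransfer ⇐ BlockToChiralScale (the blocked lattice-QCD generating functional
of gauge-invariant block observables at ONE physical scale ℓ_χ
is in the PCM low-temperature format: stiffness ≥ β₀, field h(m) with c m ≤ h/β ≤ C m, remainder
massive) → FormatStability (Bałaban's class is
open under that remainder and the two-sided law survives with constants) → ChiralTransfer.
SpinWaveLaws ⇐ SU(2) case (import the N-vector
S³ results) → SU(3) case (group-valued rebuild) → SpinWaveLaws. MassiveBody ⇐ UV existence for all m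
(shared in substance with
HeatSlicedQuarks.ContinuumQCDExists) → gluonic/singlet gap above the window (the YM-core, shared
with every route) → OS packaging
(DiagonalSpine-type compactness) → MassiveBody. Nothing filed now (k ≤ 3, depth 1).

KILL CRITERIA. A refutation of SpinWaveLaws for N = 2 or N = 3 (e.g. a sign change of the transverse
correlator, or clustering slower than √(h/β) uniformly)
closes the route (`refuted:SpinWaveLaws`) — the engine has no other source. A refutation of
ChiralWindow's LOWER law (a light-quark regime with
gap ∝ m^p, p > 1/2, along every honest reg) kills the spin-wave dictionary and pivots the chiral
clause to AnomalyRigidity's anomaly line; a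
refutation of its UPPER law would refute `IsChiralAtZero` for honest QCD and is a statement-level
event. If another route proves
IsChiralAtZero together with a light-quark gap, ChiralTransfer becomes optional but ChiralWindow
(two-sided rates) stays a live target.

NOT DECOMPOSED YET. The matching scale ℓ_χ, the constants B, f (h/β versus m), the treatment of the
signed Wilson determinant inside the window, the mixed
regime (two light + one strange-like flavour, where the PCM is SU(2) inside SU(3)), finite-volume
(ε/δ-regime) bookkeeping, and the E1 /
OS packaging inside MassiveBody are all layer-2 material; the window constant m₁ is existential on
purpose.

CHEAPEST FALSIFIER. (i) Lattice QCD data: m_π²/(m_u+m_d) constant to a few percent down to the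
physical point (GMOR; FLAG averages) — the two-sided √m law
survives. (ii) For SpinWaveLaws: a Monte Carlo of the SU(3) principal chiral model on 8⁴–16⁴ tori at
β ∈ [2,4]·β_c, h ∈ [10⁻³,10⁻¹]: fit
the transverse correlator to (2/β)·G^(√(h/β)) and check positivity at all distances — one kit job,
not run this cycle (refuter's first
test). (iii) In-Lean: the glue `closes` is checked (rc 0); no decidable instance exists.

NUMBERS. PCM tree level (tr TᵃTᵇ = δᵃᵇ/2): Re tr(g_x g_y†) ≈ N − ¼Σ_a(θ_x−θ_y)², Re tr g ≈ N − ¼θ²,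
so the spin-wave propagator is (2/β)(−Δ + h/β)⁻¹:
mass² = h/β, amplitude 2/β. QCD side: m_π² = 2B·m̂ with B = Σ/f² (GMOR), Σ^(1/3) ≈ 270 MeV, f ≈ 92
MeV, so Δ(m) ≈ √(2Bm) for m ≲ 50 MeV;
lightest meson for a tuple: m² ∝ m₍₁₎+m₍₂₎. Wilson artefacts: Aoki width ∼ a³, minimum pion mass ∼
aΛ² in the first-order scenario
(SharpeSingleton1998) — both vanish eventually in k at fixed renormalised m, which is why both laws
are stated `∀ᶠ k`.

DEFINITION REQUESTS. None needed to type the items (the PCM measure, torus distance, cylinder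
observables and the window predicate are inlined over
Matrix.specialUnitaryGroup, haarProbability, Measure.pi/withDensity, TorusSite,
QCDRegularisation.scheme, HasLatticeMassGap). Optional
de-inlining later: `Literature/Probability/LatticeModels/PrincipalChiralModel` (pcmMeasure N β h L,
torusSupDist) and a cite-fact for
Bałaban–O'Carroll 1999 once the text is held (acq-04013, cite-only).

Novelty: Searches (2026-08-16): pool — all 28 QCD theses' headers and 73 card titles/mechanism lines read;
grep "spin-wave|σ-model|chiral
Lagrangian|N-vector|O(4)" over Theses + Ideas (hits only: transverse-lattice-integrable-links = 2D
PCM INTEGRABILITY on links, graded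
variant vs Orland; cfc-twisted-circle cites Cherman–Schäfer–Ünsal's small-circle chiral Lagrangian;
none uses a low-T expansion or a
Goldstone lower bound); YangMills theses grep (BalabanOcarroll1999 cited only as "the printed
observables extension of Bałaban RG" in
TunedSequenceExists notes). Literature — `lit search --source arxiv` "Balaban low temperature
expansion classical N-vector" (0; zbMATH/crossref:
Balaban1995/1996/1998, BalabanOcarroll1999, GiulianiOtt2023 = arXiv:2302.07299, read §1), "spin wave
expansion rigorous O(N) magnetic field
exponential decay" (0), "Goldstone boson mass lower bound lattice rigorous" (0), "nonlinear sigma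
model low temperature external field
correlation decay rigorous" (0), "principal chiral model four dimensions low temperature expansion"
(0), "rigorous chiral perturbation theory
constructive" (6 irrelevant); `lit galaxy search --star all` "Low temperature properties for
correlation functions in classical N-vector" (pdf:
Dimock's Bałaban expositions only), "low temperature expansion" (textbooks); `lit frontier
QuantumFields --since 2020` (30 rows, none chiral);
barrier files GoldstoneTheorem / BanksCasher / AokiPhase / AnomalyMatching read. Also weighed and
rejected this cycle (NO  [refs: 10.1007/s002200050510, 2302.07299, doi:10.1007/s002200050510, BalabanOcarroll1999, Balaban1995, GiulianiOtt2023, ShenZhuZhu2022, BauerschmidtBodineauDagallier2023, GasserLeutwyler1984, GellmannOakesRenner1968, KawamotoSmit1981]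

Barriers (technique_class: low-T-expansion, spin-waves, chiral-transfer): - technique_class: low-T-expansion, spin-waves, chiral-transfer
- Literature.Barriers.QuantumFields.GoldstoneTheorem: used, not fought — Kastler–Robinson–Swieca say
SSB of a locally generated symmetry forbids a gap; Wilson quarks have no conserved axial current, so
the line never invokes a lattice Goldstone theorem: the exact symmetry lives in the PCM (SU(N)×SU(N)
on g), the explicit breaking is the field h > 0, and every statement is at h > 0 / m > 0 where a gap
is allowed and proved ≍ √h.
- Literature.Barriers.QuantumFields.BanksCasherCriterion: respected — no condensate or symmetry
breaking is claimed at finite volume or at m = 0; all laws are at fixed m > 0, uniform in the volume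
S ≥ L_k first, with rates in m afterwards (V → ∞ before m → 0).
- Literature.Barriers.QuantumFields.AokiPhaseDichotomy: evaded by quantifier order — both window
laws are `∀ᶠ k` at FIXED renormalised mass, where the Aoki width (∼a³) and the first-order minimum
pion mass (∼aΛ²) vanish; nothing is asserted at κ_c(β) at finite spacing, and the upper law asks for
NO uniform gap above C√m, true in either Sharpe–Singleton scenario.
- Literature.Barriers.QuantumFields.tHooftAnomalyMatching: consistent and complementary — matching
says massless N_f ≥ 3 QCD is gapless; this line asserts the stronger Goldstone RATE and would be
refuted (lower law) exactly in the exotic N_f = 2 Wigner-mode scenario matching cannot exclude; that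
is the route's stated bet.
- Literature.Barriers.QuantumFields.HoppingExpansionUn

History (route lifecycle, newest last):
- 2026-08-24T07:10:44Z · DORMANT — reconciler: no traction for 6.6 d (last activity item-evidence-added at 2026-08-17T16:47:35Z); parked, not closed — `ledger route dormant route-QuantumFields-Ch (operator:999:4089523)
- 2026-08-28T21:12:28Z · REACTIVATED — reconciler: reactivated — activity statement-closed at 2026-08-28T18:37:59Z after parking at 2026-08-24T07:10:44Z (operator:999:2054692)
- 2026-09-03T14:42:23Z · DORMANT — reconciler: no traction for 5 d (last activity statement-checked at 2026-08-29T13:53:54Z); parked, not closed — `ledger route dormant route-QuantumFields-Chiral (operator:999:23478)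

sub-problem: QCD · status: dormant · opened planner-plan-novel-QuantumFields-QCD-829546d5-v2-g7-0 2026-08-16T19:36:19Z · rev 4 · ledger route-QuantumFields-ChiralSpinWaves
GENERATED by the gate from the ledger (D-0016/17). Provers cite these decls: `theorem foo : Summit.QuantumFields.QCD.Theses.ChiralSpinWaves.<Decl> := …` in Summits/QuantumFields/QCD/Theorems/<Name>.lean.
-/

namespace Summit.QuantumFields.QCD.Theses.ChiralSpinWaves

open scoped BigOperators Topology Manifold Classical MeasureTheory ProbabilityTheory Matrix InnerProductSpace ComplexConjugate ContinuousMap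
open Filter Set Function TopologicalSpace MeasureTheory

attribute [summit_statement] _root_.QCD

/-- item stmt-QuantumFields-16580 · target · rank 0 · open · by planner
why it might fail: encodes Goldstone scaling: false if massless N_f = 2 QCD sat in an exotic anomaly-matching phase (massless baryons, no condensate) where the gap is ∝ m ≪ √m — the lower law dies; or if some flavour-singlet state dipped below c√(m₍₁₎+m₍₂₎) at small m.
sources: GellmannOakesRenner1968, GasserLeutwyler1984, SharpeSingleton1998, MontvayMunster1994, JaffeWitten2000
[target] for N_f ∈ {2,3} there is a mass-independent regularisation reg with HasMassScaling and
two-loop asymptotic scaling and constants m₁, c, C > 0 such that (lower law) for every positive mass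
tuple with all m_f ≤ m₁ the bare masses stay on the physical branch and lattice QCD has the uniform
lattice gap c·√(inf over f≠g of (m_f+m_g)), and (upper law) for every t ∈ (0, m₁] and every E > C√t
the degenerate-mass theory reg.scheme (t·1) has NO uniform lattice gap E. -/
@[route_item "route-QuantumFields-ChiralSpinWaves"]
def ChiralWindow : Prop :=
  open Literature.MathematicalPhysics.QuantumFieldTheory Literature.Probability.LatticeModels MeasureTheory in ∀ Nf : ℕ, Nf = 2 ∨ Nf = 3 → ∃ reg : QCDRegularisation Nf, reg.HasMassScaling ∧ (reg.scheme 0 0 0).HasAsymptoticScaling ∧ (∃ m₁ > (0:ℝ), ∃ c > (0:ℝ), ∃ C > (0:ℝ), (∀ m : Fin Nf → ℝ, (∀ f, 0 < m f) → (∀ f, m f ≤ m₁) → (∀ f, ∀ᶠ k in Filter.atTop, (-1 : ℝ) < (reg.scheme m 0 0).mq f k) ∧ (reg.scheme m 0 0).HasLatticeMassGap (c * Real.sqrt (⨅ p : {p : Fin Nf × Fin Nf // p.1 ≠ p.2}, (m p.1.1 + m p.1.2)))) ∧ (∀ t : ℝ, 0 < t → t ≤ m₁ → ∀ E : ℝ,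 C * Real.sqrt t < E → ¬ (reg.scheme (fun _ => t) 0 0).HasLatticeMassGap E))

/-- item stmt-QuantumFields-16581 · crux · rank 2 · open · by planner
why it might fail: N=2 (S³ = O(4) N-vector) is Bałaban–O'Carroll territory but two-sidedness, tori and uniformity down to h→0⁺ are unverified (paper paywalled); N=3 needs the low-T expansion rebuilt for a group-valued field (π₃(SU(3)) = ℤ textures); the lower law needs transverse positivity at all distances.
sources: Balaban1995, Balaban1996, Balaban1998, BalabanOcarroll1999, GiulianiOtt2023, FrohlichSimonSpencer1976
[crux] for N ∈ {2,3} there are β₀, h₀, c, C, c' > 0, K(·,·), L₀ such that for all β ≥ β₀, 0 < h ≤ h₀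
and all tori (ℤ/L)⁴ with L ≥ L₀, the SU(N) principal chiral model with weight exp(β Σ_x Σ_μ Re
tr(g_x g_(x+μ)†) + h Σ_x Re tr g_x) ∏ dg_x (Haar) satisfies: (upper) |Cov(F,F')| ≤
K(|A|,|B|)·e^(−c√(h/β)·R) for cylinder observables F, F' bounded by 1, supported on A, B at torus
sup-distance ≥ R; (lower) Cov(u(g_0), u(g_y)) ≥ (c'/β)(1+|y|)⁻²·e^(−C√(h/β)|y|) for the transverse
coordinate u(g) = Im g₀₁ and 4|y| ≤ L — exponential clustering at the spin-wave mass √(h/β),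
two-sidedly, uniformly in the volume. [difficulty: XL] -/
@[route_item "route-QuantumFields-ChiralSpinWaves"]
def SpinWaveLaws : Prop :=
  open Literature.MathematicalPhysics.QuantumFieldTheory Literature.Probability.LatticeModels MeasureTheory in ∀ N : ℕ, N = 2 ∨ N = 3 → ∀ hN : 2 ≤ N, ∃ β₀ h₀ c C c' : ℝ, 0 < β₀ ∧ 0 < h₀ ∧ 0 < c ∧ 0 < C ∧ 0 < c' ∧ ∃ (K : ℕ → ℕ → ℝ) (L₀ : ℕ), ∀ (β h : ℝ), β₀ ≤ β → 0 < h → h ≤ h₀ → ∀ (L : ℕ) [NeZero L], L₀ ≤ L → let G := Matrix.specialUnitaryGroup (Fin N) ℂ; let dist : TorusSite 4 L → TorusSite 4 L → ℕ := fun a b => Finset.univ.sup fun i : Fin 4 => ((a i - b i).valMinAbs).natAbs; let w : (TorusSite 4 L → G) → ℝ := fun g => Real.exp (β * ∑ x : TorusSite 4 L, ∑ i : Fin 4, (((g x : Matrix (Fin N) (Fin N) ℂ) * ((g (x + Pi.single i 1) : Matrix (Fin N) (Fin N) ℂ)).conjTranspose).trace).re + h * ∑ x : TorusSite 4 L, ((g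 x : Matrix (Fin N) (Fin N) ℂ).trace).re); let μ : Measure (TorusSite 4 L → G) := (Measure.pi fun _ : TorusSite 4 L => haarProbability G).withDensity fun g => ENNReal.ofReal (w g); let E : ((TorusSite 4 L → G) → ℝ) → ℝ := fun F => (∫ g, F g ∂μ) / (μ Set.univ).toReal; let u : G → ℝ := fun g => ((g : Matrix (Fin N) (Fin N) ℂ) ⟨0, by omega⟩ ⟨1, by omega⟩).im; (∀ (A B : Finset (TorusSite 4 L)) (F F' : (TorusSite 4 L → G) → ℝ), (∀ g g', (∀ x ∈ A, g x = g' x) → F g = F g') → (∀ g g', (∀ x ∈ B, g x = g' x) → F' g = F' g') → Measurable F → Measurable F' → (∀ g, |F g| ≤ 1) → (∀ g, |F' g| ≤ 1) → ∀ R : ℕ, (∀ a ∈ A, ∀ b ∈ B, R ≤ dist a b) → |E (fun g => F g * F' g) - E F * E F'| ≤ K A.card B.card * Real.exp (-(c * Real.sqrt (h / β) * R))) ∧ (∀ y : TorusSite 4 L, 4 * dist 0 y ≤ L → c' / β / ((1 : ℝ) + dist 0 y) ^ 2 * Real.exp (-(C * Real.sqrt (h / β) * dist 0 y)) ≤ E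 (fun g => u (g 0) * u (g y)) - E (fun g => u (g 0)) * E (fun g => u (g y)))

/-- item stmt-QuantumFields-16582 · crux · rank 3 · open · by planner
why it might fail: needs SχSB and a derivation of the chiral Lagrangian from blocked lattice QCD in Bałaban's format — no rigorous handle at N_c = 3; the blocked measure may be no small perturbation of any PCM (σ/ρ at the matching scale, Wilson O(a) chirality breaking, signed determinant).
sources: KawamotoSmit1981, GasserLeutwyler1984, SharpeSingleton1998, BalabanOcarroll1999, MontvayMunster1994
[crux] the spin-wave laws of the SU(2)/SU(3) principal chiral models (SpinWaveLaws) imply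
ChiralWindow: blocked to the chiral scale ℓ_χ, light-quark Wilson lattice QCD along a suitably tuned
AF regularisation is a low-temperature SU(N_f) principal chiral model in a field h ≍ B·m·ℓ_χ⁴-units
(plus a massive remainder), so the PCM's two-sided √(h/β) law becomes the two-sided √m law of the
window, with m_crit(k) := the bare mass of vanishing effective field and Z_m(k) read off the law.
[deps: SpinWaveLaws] [difficulty: open-problem] -/
@[route_item "route-QuantumFields-ChiralSpinWaves"]
def ChiralTransfer : Prop :=
  SpinWaveLaws → ChiralWindow

/-- item stmt-QuantumFields-16583 · crux · rank 4 · open · by planner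
why it might fail: this is the old pool target in full (UV with light dynamical Wilson quarks, E0–E4 incl. rotations, gluonic gap at every mass incl. the intermediate strange-like regime m₁ < m ≲ Λ), now without the m_crit-shift escape; any of those can fail or stay out of reach.
sources: JaffeWitten2000, OsterwalderSeiler1978, MontvayMunster1994, Luscher1977, Balaban1995
[crux] for N_f ∈ {2,3}, every regularisation with HasMassScaling, asymptotic scaling and the two
window laws of ChiralWindow realises the OS body of QCDOf at EVERY positive mass tuple: species
renormalisations and OS data with IsQCDAlong, non-trivial non-Gaussian glue, non-decoupled
flavour-changing pseudoscalars, and one Δ(m) > 0 for T.HasMassGap and HasLatticeMassGap — the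
pre-re-type programme, for a reg whose m_crit and Z_m are pinned by the window (no threshold
freedom). [deps: ChiralTransfer] [difficulty: open-problem] -/
@[route_item "route-QuantumFields-ChiralSpinWaves"]
def MassiveBody : Prop :=
  open Literature.MathematicalPhysics.QuantumFieldTheory Literature.Probability.LatticeModels MeasureTheory in ∀ Nf : ℕ, Nf = 2 ∨ Nf = 3 → ∀ reg : QCDRegularisation Nf, reg.HasMassScaling → (reg.scheme 0 0 0).HasAsymptoticScaling → (∃ m₁ > (0:ℝ), ∃ c > (0:ℝ), ∃ C > (0:ℝ), (∀ m : Fin Nf → ℝ, (∀ f, 0 < m f) → (∀ f, m f ≤ m₁) → (∀ f, ∀ᶠ k in Filter.atTop, (-1 : ℝ) < (reg.scheme m 0 0).mq f k) ∧ (reg.scheme m 0 0).HasLatticeMassGap (c * Real.sqrt (⨅ p : {p : Fin Nf × Fin Nf // p.1 ≠ p.2}, (m p.1.1 + m p.1.2)))) ∧ (∀ t : ℝ, 0 < t → t ≤ m₁ → ∀ E : ℝ, C * Real.sqrt t < E → ¬ (reg.scheme (fun _ => t) 0 0).HasLatticeMassGap E)) → ∀ m : Fin Nf → ℝ, (∀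 f, 0 < m f) → ∃ (z shift : QCDField Nf → ℕ → ℝ) (T : OSData (QCDField Nf) 4), IsQCDAlong (reg.scheme m z shift) T ∧ T.IsNontrivial QCDField.glue ∧ T.IsNonGaussian QCDField.glue ∧ (∀ f g : Fin Nf, f ≠ g → T.IsNontrivial (QCDField.pseudoRe f g)) ∧ ∃ Δ > 0, T.HasMassGap Δ ∧ (reg.scheme m z shift).HasLatticeMassGap Δ

/-- item stmt-QuantumFields-16584 · assembly · rank 1 · closed · proved by Summit.QuantumFields.QCD.Theorems.chiralSpinWaves_assembly_proof (prover) · by planner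
sources: GellmannOakesRenner1968, JaffeWitten2000
[assembly] SpinWaveLaws → ChiralTransfer → MassiveBody → QCD (ChiralWindow is the intermediate;
IsChiralAtZero is derived inside `closes`). -/
@[route_item "route-QuantumFields-ChiralSpinWaves"]
def Assembly : Prop :=
  SpinWaveLaws → ChiralTransfer → MassiveBody → QCD

-- `Assembly` holds: proved by `Summit.QuantumFields.QCD.Theorems.chiralSpinWaves_assembly_proof` (its module imports this route file, so no `_holds` link can be stated here).

/-! D-0027 §2.1 — DECIDING THEOREM (planner-authored via `route open/edit --closes-file`; by planner-rrepair-QuantumFields-ChiralSpinWaves--e606c058-0 2026-08-16T23:14:35Z):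
its hypotheses are this route's items and its conclusion the sub-problem Statement (glue_lint), and it elaborates with this file. -/

@[closes "route-QuantumFields-ChiralSpinWaves"] theorem closes (h1 : SpinWaveLaws) (h2 : ChiralTransfer) (h3 : MassiveBody) : QCD := by
  -- Statement re-type p117723: the conjunct `reg.IsChiralAtZero` of `QCDOf` is PROVED here (no extra hypothesis) from
  -- ChiralWindow's upper window law at the degenerate tuple `fun _ => t`, `t := min m₁ (ε/(2C))²` (so `C·√t ≤ ε/2 < ε`).
  have hW : ChiralWindow := h2 h1
  have main : ∀ Nf : ℕ, Nf = 2 ∨ Nf = 3 → QCDOf Nf := by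
    intro Nf hNf
    obtain ⟨reg, hms, haf, hwin⟩ := hW Nf hNf
    refine ⟨reg, hms, ?_, fun m hm => h3 Nf hNf reg hms haf hwin m hm⟩
    obtain ⟨m₁, hm₁, c, hc, C, hC, hlow, hup⟩ := hwin
    unfold Literature.MathematicalPhysics.QuantumFieldTheory.QCDRegularisation.IsChiralAtZero
    intro ε hε
    have ht0 : 0 < min m₁ ((ε / (2 * C)) ^ 2) := lt_min hm₁ (by positivity)
    have ht1 : min m₁ ((ε / (2 * C)) ^ 2) ≤ m₁ := min_le_left _ _
    have hsq : Real.sqrt (min m₁ ((ε / (2 * C)) ^ 2)) ≤ ε / (2 * C) := by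
      calc Real.sqrt (min m₁ ((ε / (2 * C)) ^ 2)) ≤ Real.sqrt ((ε / (2 * C)) ^ 2) :=
            Real.sqrt_le_sqrt (min_le_right _ _)
        _ = ε / (2 * C) := Real.sqrt_sq (by positivity)
    have hlt : C * Real.sqrt (min m₁ ((ε / (2 * C)) ^ 2)) < ε := by
      have h1' : C * Real.sqrt (min m₁ ((ε / (2 * C)) ^ 2)) ≤ C * (ε / (2 * C)) :=
        mul_le_mul_of_nonneg_left hsq hC.le
      have h2' : C * (ε / (2 * C)) = ε / 2 := by field_simp
      linarith
    exact ⟨fun _ => min m₁ ((ε / (2 * C)) ^ 2), fun _ => ht0, hup _ ht0 ht1 ε hlt⟩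
  exact ⟨main 2 (Or.inl rfl), main 3 (Or.inr rfl)⟩

end Summit.QuantumFields.QCD.Theses.ChiralSpinWaves
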